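import Literature.MathematicalPhysics.QuantumFieldTheory.Balaban1983to89.B9Eq360DeltaPrimeACubeY
import Literature.MathematicalPhysics.QuantumFieldTheory.Balaban1983to89.B9Eq357CubeLetters

/-!
# `Balaban1983to89.B9Eq359CubeKernelsAtOne` — [Balaban1985BackgroundPropagators] (3.58)–(3.59) p. 402 FOR THE CUBE's KERNEL LETTERS `kF`, `sF`
# (FILE 1's `kFCubeY`, `sFCubeY`) AT THE RECORD's TRANSPORTER `parSymY`, CURRENCY A (r05's `B9Eq357CubeLetters.norm_Rclm_qpTc_prod_sub_le`),
# in the `hkF`/`hsF` shapes of `B9Thm34SectBUniformR1.thm34_Gp_uniform`; and the algebra «a two-sided inverse in coordinates is a unit» —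
# sub-row G-B9-LETTERS, module M5.1b-G′, FILE 7a-prep of seat p33's plan

statement-level skeleton of published theorems with citation tags; proofs where landed; nothing here is a claim about the Yang–Mills mass gap

CITATION HEADER (lean-in-tree rule).  B9 = T. Bałaban, *Propagators for lattice gauge theories in a background field*, Commun. Math. Phys. **99** (1985)
389–434 [Balaban1985BackgroundPropagators] (held `paper:balaban1985-cmp99-background-propagators`; journal page = PDF page + 388): (3.57)–(3.59) pp. 401–402
«|(F′_{2,j}(A)λ)(y)| ≦ O(1)α₁(Q̃′_j|λ|)(y)», «a similar expansion for the adjoint operator»; p. 401 «|(U′U)(Γ)(U(Γ))⁻¹ − 1| < O(1)α₁»; (3.19) p. 393;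
(3.24) p. 394; (3.37) p. 396; (3.40) p. 397; p. 409 l. 3–5 (the cube letters obey the same inequalities); Thm 3.4 p. 400 («G′(U′U) = (Δ′_a(U′U))⁻¹ exists»).
Rows B9.(3.58)–(3.59) (cells only; no row head changes).

WHY THIS FILE (cell lit-balaban, sub-row G-B9-LETTERS, module M5.1b-G′ booked to seat p33 g96).  FILE 6 (`B9Cor35GpAtCubeLetters.cor35_Gp_cube`) leaves,
among the `A`-dependent binders of `thm34_Gp_uniform`, the (3.59) kernel sizes `hkF : ‖kF y x‖ ≤ C_q·α₁·w(y)` (on the block) and `hsF : ‖sF x‖ ≤ C_q·α₁`.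
For FILE 1's letters at the record's transporter `parSymY` and the product configuration `e^{iηa}·U` (`U` `G`-valued of unit norm — e.g. `U = 1`), r05's
currency-A estimate `B9Eq357CubeLetters.norm_Rclm_qpTc_prod_sub_le` (the transporters of `Q′_□` along the taxicab contour from the cube-block corner differ
by `≤ 4(d+1)e^{3(d+1)/2}α₁` under the own-level (3.37)) gives both at once; §1 is that dictionary.  §2 is the algebra FILE 7a uses to read Theorem 3.4's
conclusion «`(Δp − conj b V′)·G′(U′U) = 1 = G′(U′U)·(Δp − conj b V′)`» back as «`Δ′_{a,□}(Ṽ)` is a unit» (FILE 4's `hunit`).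

WHAT IS PROVED (1 `def` with body — the constant `Cq d`; 0 sorry; 0 new named facts; standard axioms):
* §1 `Cq`, `Cq_nonneg`, `kQCubeY_parSymY_eq`, `sQCubeY_parSymY_eq` (`sQ(z) = R(qpTc(s(z), z)⁻¹)`, `parSymY_swap`), ★★`norm_kFCubeY_parSymY_le` (`hkF` with
  `w = W⁻¹`), ★★`norm_sFCubeY_parSymY_le` (`hsF`), `ownLevel_of_blockwise` (Thm 3.4's blockwise `‖A_k(x)‖ ≤ α₁(Lⁿη)⁻¹` ⟹ the own-level `η‖a_ν(v)‖ ≤ α₁L^{−n}`);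
* §2 ★`isUnit_of_conj_laws` (`conj b(r·T|_ℝ)` two-sided invertible, `r ≠ 0` ⟹ `IsUnit T`).

PROOF.  Ours (bookkeeping over r05's estimate; linear algebra).  HONEST SCOPE: `[NormOneClass 𝔸]` for §1 (r05's/p21's product-run estimates); the base
`U` is `G`-valued with `‖u‖ ≤ 1` on `G` (at `U = 1` take any `G`); nothing on `d = 4`, the continuum, reflection positivity or the mass gap; NOT a node
discharge; no row head changes.  RELATED, NOT DUPLICATED: p21's `B9Eq358TaxiLettersY.norm_kFY_parSymY_le / norm_sFY_parSymY_le` (the MEMBER's letters,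
member blocks), r05's `B9Eq357CubeLetters.norm_kernelLetter_QpCubeY_prod_sub_le` (r05's `q′(s,z)•(R − R)` packaging of the same estimate).
-/

noncomputable section

namespace Literature.MathematicalPhysics.QuantumFieldTheory.Balaban1983to89.B9Eq359CubeKernelsAtOne

open Literature.MathematicalPhysics.QuantumFieldTheory.Balaban1983to89
open Literature.MathematicalPhysics.QuantumFieldTheory.Balaban1983to89.B6KLevelCensusIndexV1 (KIdx)
open Literature.MathematicalPhysics.QuantumFieldTheory.Balaban1983to89.B6Cover236MultiLevelBlocks (cubes)
open Literature.MathematicalPhysics.QuantumFieldTheory.Balaban1983to89.B6Geom246MultiLevelBoxL0 (blkOf)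
open Literature.MathematicalPhysics.QuantumFieldTheory.Balaban1983to89.B6GlobalChartV1 (PV toBox boxEquiv)
open Literature.MathematicalPhysics.QuantumFieldTheory.Balaban1983to89.B6Ineq268MultiLevelBoxL0 (W W_pos)
open Literature.MathematicalPhysics.QuantumFieldTheory.Balaban1983to89.B9CubeLettersOpsL0 (cubeFamY)
open Literature.MathematicalPhysics.QuantumFieldTheory.Balaban1983to89.B9CubeLettersBondOpsL0 (BlkCubeY blkCornerCubeY qpTc)
open Literature.MathematicalPhysics.QuantumFieldTheory.Balaban1983to89.B9Eq357CubeLetters (norm_Rclm_qpTc_prod_sub_le const358_nonneg)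
open Literature.MathematicalPhysics.QuantumFieldTheory.Balaban1983to89.B9Eq360DeltaPrimeAY (Rclm mulY AfldY chartA chartA_apply)
open Literature.MathematicalPhysics.QuantumFieldTheory.Balaban1983to89.B9Eq360DeltaPrimeACubeY (blkCubeY blkCubeY_apply kQCubeY sQCubeY kFCubeY sFCubeY)
open Literature.MathematicalPhysics.QuantumFieldTheory.Balaban1983to89.B9Eq39Adjoint (fluct)
open Literature.MathematicalPhysics.QuantumFieldTheory.Balaban1983to89.B9Eq352DivFormLetters (conj coordEquiv)
open Literature.MathematicalPhysics.QuantumFieldTheory.Balaban1983to89.Node00 (SiteY CfgY SiteParY toKT parSymY parSymY_swap)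

variable {d ℓ : ℕ} {hd : 1 ≤ d + 1} {hL : Odd (ℓ + 1) ∧ 1 < ℓ + 1} {b₀ b₁ : ℝ}

/-! ## §1  (3.58)∕(3.59) for FILE 1's kernel letters `kF`, `sF` at the record's `parSymY`, currency A (r05's `norm_Rclm_qpTc_prod_sub_le`) -/

section Kernels

variable {𝔸 : Type} [NormedRing 𝔸] [NormedAlgebra ℂ 𝔸] [CompleteSpace 𝔸]
variable (i : KIdx d ℓ hd hL b₀ b₁) (c : ↥(cubes (toKT i).D.toDomains)) (G : Subgroup 𝔸ˣ)

/-- **the (3.58) size `C_q = 4(d+1)e^{3(d+1)/2}`** of r05's currency-A estimate. [cite: Balaban1985BackgroundPropagators, (3.58) p.402] -/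
def Cq (d : ℕ) : ℝ := 4 * ((d : ℝ) + 1) * Real.exp (3 * (((d : ℝ) + 1) / 2))

/-- `0 ≤ C_q`. [cite: Balaban1985BackgroundPropagators, (3.58) p.402, bookkeeping] -/
theorem Cq_nonneg (d : ℕ) : 0 ≤ Cq d := const358_nonneg

/-- FILE 1's kernel letter at `parSymY` is `W(s)⁻¹·R(qpTc(s, w))` (r05's transporter of `Q′_□`). [cite: Balaban1985BackgroundPropagators, (3.19) p.393, p.409, dictionary] -/
theorem kQCubeY_parSymY_eq (U : CfgY 𝔸 i) (s : BlkCubeY i c) (w : SiteY i) :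
    kQCubeY i c (parSymY i) U s w = (W (cubeFamY i c).toDomains s)⁻¹ • Rclm (qpTc i c (parSymY i) U s w) := rfl

/-- FILE 1's starred letter at `parSymY` is `R(qpTc(s(z), z)⁻¹)` (the transporter back to the corner is the inverse, `parSymY_swap`).
[cite: Balaban1985BackgroundPropagators, (3.24) p.394, (3.40) p.397, dictionary] -/
theorem sQCubeY_parSymY_eq (U : CfgY 𝔸 i) (z : SiteY i) :
    sQCubeY i c (parSymY i) U z = Rclm (qpTc i c (parSymY i) U (blkCubeY i c z) z)⁻¹ := by
  unfold sQCubeY qpTc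
  rw [parSymY_swap]

/-- ★★ **(3.58) FOR THE CUBE's KERNEL LETTER, R1's `hkF` SHAPE**: for a `G`-valued (unit-norm) base `U`, a multiplier `e^{iηa}` with the own-level (3.37)
`η‖a_ν(v)‖ ≤ α₁L^{−n(s)}` on the bonds based in the cube block `Δ(s)`, `α₁ ≤ 1/4`: `‖kF(s, w)‖ ≤ C_q·α₁·W(s)⁻¹` for `w ∈ Δ(s)`.
[cite: Balaban1985BackgroundPropagators, (3.58) p.402, (3.19) p.393, (3.37) p.396, p.409 l.3–5] -/
theorem norm_kFCubeY_parSymY_le [NormOneClass 𝔸] (hG1 : ∀ u : 𝔸ˣ, u ∈ G → ‖(u : 𝔸)‖ ≤ 1) {U : CfgY 𝔸 i} (hU : ∀ μ x, U μ x ∈ G)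
    {η : ℝ} (hη : 0 ≤ η) (a : AfldY 𝔸 i) (s : BlkCubeY i c) {α₁ : ℝ} (hα₁ : 0 ≤ α₁) (hα₁4 : α₁ ≤ 1 / 4)
    (ha : ∀ (ν : Fin (d + 1)) (v : Site (PV d ℓ i.m i.K hd hL) 0), blkOf (cubeFamY i c).toDomains (toBox i.hN v) = s →
      η * ‖a ν v‖ ≤ α₁ * ((((ℓ + 1) ^ s.1.1 : ℕ) : ℝ))⁻¹)
    (w : SiteY i) (hw : blkCubeY i c w = s) :
    ‖kFCubeY i c (parSymY i) U (mulY i (fluct η a) U) s w‖ ≤ Cq d * α₁ * (W (cubeFamY i c).toDomains s)⁻¹ := by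
  have hW := W_pos (cubeFamY i c).toDomains s
  have h := (norm_Rclm_qpTc_prod_sub_le i c G hG1 hU hη a s hα₁ hα₁4 ha (z := w) hw).1
  unfold kFCubeY
  have e : (W (cubeFamY i c).toDomains s)⁻¹ • (Rclm (qpTc i c (parSymY i) (mulY i (fluct η a) U) s w) - Rclm (qpTc i c (parSymY i) U s w)) =
      (W (cubeFamY i c).toDomains s)⁻¹ • Rclm (qpTc i c (parSymY i) (mulY i (fluct η a) U) s w) -
        (W (cubeFamY i c).toDomains s)⁻¹ • Rclm (qpTc i c (parSymY i) U s w) := smul_sub _ _ _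
  rw [kQCubeY_parSymY_eq, kQCubeY_parSymY_eq, ← e, norm_smul, Real.norm_eq_abs, abs_of_pos (inv_pos.2 hW)]
  calc (W (cubeFamY i c).toDomains s)⁻¹ * ‖Rclm (qpTc i c (parSymY i) (mulY i (fluct η a) U) s w) - Rclm (qpTc i c (parSymY i) U s w)‖
      ≤ (W (cubeFamY i c).toDomains s)⁻¹ * (4 * ((d : ℝ) + 1) * Real.exp (3 * (((d : ℝ) + 1) / 2)) * α₁) :=
        mul_le_mul_of_nonneg_left h (inv_nonneg.2 hW.le)
    _ = Cq d * α₁ * (W (cubeFamY i c).toDomains s)⁻¹ := by unfold Cq; ring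

/-- ★★ **(3.59) FOR THE CUBE's STARRED LETTER, R1's `hsF` SHAPE**: `‖sF(z)‖ ≤ C_q·α₁` under the own-level (3.37) on the block of `z`.
[cite: Balaban1985BackgroundPropagators, (3.59) p.402, (3.24) p.394, (3.37) p.396, p.409 l.3–5] -/
theorem norm_sFCubeY_parSymY_le [NormOneClass 𝔸] (hG1 : ∀ u : 𝔸ˣ, u ∈ G → ‖(u : 𝔸)‖ ≤ 1) {U : CfgY 𝔸 i} (hU : ∀ μ x, U μ x ∈ G)
    {η : ℝ} (hη : 0 ≤ η) (a : AfldY 𝔸 i) (z : SiteY i) {α₁ : ℝ} (hα₁ : 0 ≤ α₁) (hα₁4 : α₁ ≤ 1 / 4)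
    (ha : ∀ (ν : Fin (d + 1)) (v : Site (PV d ℓ i.m i.K hd hL) 0), blkOf (cubeFamY i c).toDomains (toBox i.hN v) = blkCubeY i c z →
      η * ‖a ν v‖ ≤ α₁ * ((((ℓ + 1) ^ (blkCubeY i c z).1.1 : ℕ) : ℝ))⁻¹) :
    ‖sFCubeY i c (parSymY i) U (mulY i (fluct η a) U) z‖ ≤ Cq d * α₁ := by
  have h := (norm_Rclm_qpTc_prod_sub_le i c G hG1 hU hη a (blkCubeY i c z) hα₁ hα₁4 ha (z := z) rfl).2
  unfold sFCubeY
  rw [sQCubeY_parSymY_eq, sQCubeY_parSymY_eq]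
  exact h.trans (le_of_eq (by unfold Cq; ring))

omit [NormedAlgebra ℂ 𝔸] [CompleteSpace 𝔸] in
/-- the own-level (3.37) on the chart from Theorem 3.4's blockwise bound `‖A_k(x)‖ ≤ α₁·(Lⁿ⁽ˣ⁾η)⁻¹` (`A = chartA a`): `η‖a_ν(v)‖ ≤ α₁L^{−n(s)}` on `Δ(s)`.
[cite: Balaban1985BackgroundPropagators, (3.37) p.396, (3.41) p.397, bookkeeping] -/
theorem ownLevel_of_blockwise {η : ℝ} (hη : 0 < η) (a : AfldY 𝔸 i) {α₁ : ℝ}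
    (hA : ∀ (k : Fin (d + 1)) (x : SiteY i), ‖chartA i a k x‖ ≤ α₁ * (((((ℓ + 1) ^ (blkCubeY i c x).1.1 : ℕ) : ℝ)) * η)⁻¹)
    (s : BlkCubeY i c) (ν : Fin (d + 1)) (v : Site (PV d ℓ i.m i.K hd hL) 0) (hv : blkOf (cubeFamY i c).toDomains (toBox i.hN v) = s) :
    η * ‖a ν v‖ ≤ α₁ * ((((ℓ + 1) ^ s.1.1 : ℕ) : ℝ))⁻¹ := by
  have h := hA ν (toBox i.hN v)
  have e2 : chartA i a ν (toBox i.hN v) = a ν v := by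
    rw [chartA_apply, ← B6GlobalChartV1.boxEquiv_apply]
    exact congrArg (a ν) ((boxEquiv i.hN).symm_apply_apply v)
  have hb : blkCubeY i c (toBox i.hN v) = s := hv
  rw [e2, hb, mul_inv, ← mul_assoc] at h
  have hL : (0 : ℝ) < (((ℓ + 1) ^ s.1.1 : ℕ) : ℝ) := by positivity
  calc η * ‖a ν v‖ ≤ η * (α₁ * ((((ℓ + 1) ^ s.1.1 : ℕ) : ℝ))⁻¹ * η⁻¹) := mul_le_mul_of_nonneg_left h hη.le
    _ = α₁ * ((((ℓ + 1) ^ s.1.1 : ℕ) : ℝ))⁻¹ := by field_simp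

end Kernels

/-! ## §2  A unit in coordinates is a unit: `conj b(r·T) ` two-sided invertible ⟹ `T` invertible (`conj b`, `restrictScalars`, `r ≠ 0`) -/

section Unit

variable {𝔸 : Type} [NormedRing 𝔸] [NormedAlgebra ℂ 𝔸] [CompleteSpace 𝔸]
variable {ι : Type} [Fintype ι] (b : Module.Basis ι ℝ 𝔸) {S : Type}

omit [CompleteSpace 𝔸] in
/-- ★ **READING A UNIT BACK FROM THE COORDINATES**: if `conj b (r·T|_ℝ)` has a two-sided inverse in `End_ℝ(S × ι → ℝ)` and `r ≠ 0`, then the `ℂ`-linear `T`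
is a unit (bijectivity is read through the linear equivalence `coordEquiv b` and the scaling). [cite: Balaban1985BackgroundPropagators, Thm 3.4 p.400 («G′(U′U) = (Δ′_a(U′U))⁻¹»), bookkeeping] -/
theorem isUnit_of_conj_laws (T : (S → 𝔸) →ₗ[ℂ] (S → 𝔸)) {r : ℝ} (hr : r ≠ 0) (Y : Module.End ℝ (S × ι → ℝ))
    (h1 : conj b (r • T.restrictScalars ℝ) * Y = 1) (h2 : Y * conj b (r • T.restrictScalars ℝ) = 1) : IsUnit T := by
  rw [Module.End.isUnit_iff]
  have hX : IsUnit (conj b (r • T.restrictScalars ℝ)) := isUnit_iff_exists.2 ⟨Y, h1, h2⟩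
  have hbX : Function.Bijective (conj b (r • T.restrictScalars ℝ)) := (Module.End.isUnit_iff _).1 hX
  -- `conj b X = e ∘ X ∘ e⁻¹` with `e = coordEquiv b`
  have hconj : ∀ v, conj b (r • T.restrictScalars ℝ) v = coordEquiv b ((r • T.restrictScalars ℝ) ((coordEquiv b).symm v)) := fun v => rfl
  have hbr : Function.Bijective (r • T.restrictScalars ℝ : Module.End ℝ (S → 𝔸)) := by
    have e1 : (fun v => (r • T.restrictScalars ℝ : Module.End ℝ (S → 𝔸)) v) =
        fun v => (coordEquiv b).symm (conj b (r • T.restrictScalars ℝ) (coordEquiv b v)) := by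
      funext v; rw [hconj, LinearEquiv.symm_apply_apply, LinearEquiv.symm_apply_apply]
    show Function.Bijective (fun v => (r • T.restrictScalars ℝ : Module.End ℝ (S → 𝔸)) v)
    rw [e1]
    exact (coordEquiv b).symm.bijective.comp (hbX.comp (coordEquiv b).bijective)
  -- unscale
  have hsm : (fun v => T v) = fun v => r⁻¹ • ((r • T.restrictScalars ℝ : Module.End ℝ (S → 𝔸)) v) := by
    funext v
    rw [LinearMap.smul_apply, LinearMap.restrictScalars_apply, smul_smul, inv_mul_cancel₀ hr, one_smul]
  show Function.Bijective (fun v => T v)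
  rw [hsm]
  have hsc : Function.Bijective (fun w : S → 𝔸 => r⁻¹ • w) :=
    ⟨fun w₁ w₂ h => by simpa [smul_smul, mul_inv_cancel₀ hr] using congrArg (fun w => r • w) h,
      fun w => ⟨r • w, by simp [smul_smul, inv_mul_cancel₀ hr]⟩⟩
  exact hsc.comp hbr

end Unit

end Literature.MathematicalPhysics.QuantumFieldTheory.Balaban1983to89.B9Eq359CubeKernelsAtOne

end
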